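import Summits.Ventures.YMGap.RobustBall.BoundaryFreeEnergyBoxes
import Summits.Ventures.YMGap.RobustBall.WilsonOneStateSymmetry
import Summits.Ventures.YMGap.RobustBall.PlaquettePositivity
import HarnessLib

/-!
# Venture YMGap, track ROBUST-BALL — «C-DS-I» on cubes: the `1/M` RATE and the UNIFORM-IN-THE-BOUNDARY-FIELD van Hove LIMIT,
# `SU(2)` on `ℤ⁴`, EVERY `0 ≤ β_W ≤ 9/25`

HONEST FRAMING. WHAT THIS IS: a venture file (cell `pub-ymgap`, track Y2 ROBUST-BALL / DS, seat ds-3, theorems only, 0 compute): bookkeeping on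
top of `BoundaryFreeEnergyBoxes.su2_abs_log_normaliser_box_div_sub_le`. `SU(2)`, `d = 4`, tree coupling `0 ≤ b ≤ 9/50`, `Λ_M = boxLinks 4 M`:
* `pow_four_sub_pow_four_le` — `(2M+3)⁴ − (2(M−4K)+1)⁴ ≤ 108(8K+2)(2M+1)³` (`a⁴ − c⁴ ≤ (a − c)·4a³`, `(2M+3)³ ≤ 27(2M+1)³`);
* ★★ `su2_abs_log_normaliser_box_div_sub_le_inv` — for every `4K ≤ M` and EVERY boundary field `η`:
  `|log Z_{Λ_M}(b|η)/#T(Λ_M) − f(b)/6| ≤ b·(1024√2·exp(−κ₁(R_G(2b))·K) + 432(8K+2)/(2M+1))` — exponentially small in the depth budget `K` plus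
  `O(K/M)`;
* ★★★ `su2_log_normaliser_box_div_uniform_limit` — VAN HOVE WITH ARBITRARY BOUNDARY CONDITIONS, UNIFORMLY: for every `ε > 0` there is `M₀` with
  `|log Z_{Λ_M}(b|η)/#T(Λ_M) − f(b)/6| ≤ ε` for ALL `M ≥ M₀` and ALL boundary fields `η`;
* `surface_sum_box_le` (the cube's surface sum ≤ `C e^{−κK}·#T + 24((2M+3)⁴ − (2(M−4K)+1)⁴)`), ★★ `su2_abs_kernel_energy_box_div_sub_le_inv` and
  ★★★ `su2_kernel_energy_box_div_uniform_limit` — the same two statements for the MEAN ENERGY PER PLAQUETTE `γ_{Λ_M}^b(S_{Λ_M}|η)/#T(Λ_M)`, whose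
  limit is the infinite-volume mean plaquette energy `2 − μ(Re tr U_{p₀})` of the (unique, axis-symmetric) DLR state `μ` at `b`
  (`WilsonOneStateSymmetry.su2_wilson_oneState_symmetric`, `PlaquettePositivity.integral_plaquetteObs_eq`).
WHAT THIS IS NOT: lattice strong coupling; nothing continuum / Clay. Everything here is proved. [folklore]
-/

noncomputable section

open MeasureTheory ProbabilityTheory Filter Topology Real Finset Set
open scoped NNReal
open Literature.Probability.LatticeModels hiding configShift configShift_apply
open Literature.MathematicalPhysics.QuantumLattice
open Literature.MathematicalPhysics.QuantumFieldTheory (haarProbability)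
open Summit.Ventures.YMGap.StarWindowGauge (gaugeR gaugeR_lt_one_of_le)
open Summit.Ventures.YMGap.StarLemmaG (gaugeR_nonneg)

namespace Summit.Ventures.YMGap.RobustBall

namespace BoundaryFreeEnergy

/-- `(2M+3)⁴ − (2(M−4K)+1)⁴ ≤ 108(8K+2)(2M+1)³` for `4K ≤ M` (`a⁴ − c⁴ ≤ (a − c)·4a³`, `a = 2M+3 ≤ 3(2M+1)`). [folklore] -/
theorem pow_four_sub_pow_four_le {M K : ℕ} (hK : 4 * K ≤ M) :
    (2 * (M : ℝ) + 3) ^ 4 - (2 * ((M : ℝ) - 4 * K) + 1) ^ 4 ≤ 108 * (8 * K + 2) * (2 * (M : ℝ) + 1) ^ 3 := by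
  have hKM : (4 * K : ℝ) ≤ M := by exact_mod_cast hK
  have hK0 : (0 : ℝ) ≤ K := Nat.cast_nonneg K
  have hM0 : (0 : ℝ) ≤ M := Nat.cast_nonneg M
  set a : ℝ := 2 * (M : ℝ) + 3 with ha
  set c : ℝ := 2 * ((M : ℝ) - 4 * K) + 1 with hc
  have hc0 : 0 ≤ c := by rw [hc]; linarith
  have hca : c ≤ a := by rw [hc, ha]; linarith
  have ha0 : 0 ≤ a := hc0.trans hca
  have h1 : a ^ 4 - c ^ 4 ≤ (a - c) * (4 * a ^ 3) := by
    have : a ^ 4 - c ^ 4 = (a - c) * (a ^ 3 + a ^ 2 * c + a * c ^ 2 + c ^ 3) := by ring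
    rw [this]
    refine mul_le_mul_of_nonneg_left ?_ (by linarith)
    nlinarith [mul_le_mul hca hca hc0 ha0, pow_le_pow_left₀ hc0 hca 2, pow_le_pow_left₀ hc0 hca 3, mul_nonneg ha0 hc0,
      mul_le_mul_of_nonneg_left hca ha0, mul_le_mul_of_nonneg_left (pow_le_pow_left₀ hc0 hca 2) ha0]
  have h2 : a - c = 8 * K + 2 := by rw [ha, hc]; ring
  have h3 : a ^ 3 ≤ 27 * (2 * (M : ℝ) + 1) ^ 3 := by
    have : a ≤ 3 * (2 * (M : ℝ) + 1) := by rw [ha]; linarith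
    calc a ^ 3 ≤ (3 * (2 * (M : ℝ) + 1)) ^ 3 := pow_le_pow_left₀ ha0 this 3
      _ = 27 * (2 * (M : ℝ) + 1) ^ 3 := by ring
  rw [h2] at h1
  have h4 := mul_le_mul_of_nonneg_left h3 (by positivity : (0 : ℝ) ≤ (8 * K + 2) * 4)
  nlinarith [h1, h4]

/-- ★★ **THE `1/M` RATE**: for every `4K ≤ M` and EVERY boundary field `η`,
`|log Z_{Λ_M}(b|η)/#T(Λ_M) − f(b)/6| ≤ b·(1024√2·exp(−κ₁(R_G(2b))·K) + 432(8K+2)/(2M+1))`. [folklore] -/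
theorem su2_abs_log_normaliser_box_div_sub_le_inv {b : ℝ} (hb0 : 0 ≤ b) (hb : b ≤ 9 / 50) {M K : ℕ} (hK : 4 * K ≤ M)
    (η : LGConfig 4 (SUN 2)) :
    |Real.log (∫ ζ, Real.exp (-b * wilsonBoundaryAction (fundamentalRep (Fin 2)) (boxLinks 4 M) (glueWith (boxLinks 4 M) ζ η))
          ∂(Measure.pi fun _ : ↥(boxLinks 4 M) => haarProbability (SUN 2))) / (plaquettesTouching (boxLinks 4 M)).card -
        freeEnergyDensity 4 (fundamentalRep (Fin 2)) b / 6| ≤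
      b * (1024 * Real.sqrt 2 * Real.exp (-(starRate 4 (gaugeR (2 * b)) * K)) + 432 * (8 * K + 2) / (2 * (M : ℝ) + 1)) := by
  refine (su2_abs_log_normaliser_box_div_sub_le hb0 hb hK η).trans (mul_le_mul_of_nonneg_left ?_ hb0)
  have hM : (0 : ℝ) < 2 * (M : ℝ) + 1 := by positivity
  have h := pow_four_sub_pow_four_le hK
  have hle : 4 * (((2 * (M : ℝ) + 3) ^ 4 - (2 * ((M : ℝ) - 4 * K) + 1) ^ 4) / (2 * (M : ℝ) + 1) ^ 4) ≤
      432 * (8 * K + 2) / (2 * (M : ℝ) + 1) :=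
    calc 4 * (((2 * (M : ℝ) + 3) ^ 4 - (2 * ((M : ℝ) - 4 * K) + 1) ^ 4) / (2 * (M : ℝ) + 1) ^ 4)
        ≤ 4 * ((108 * (8 * K + 2) * (2 * (M : ℝ) + 1) ^ 3) / (2 * (M : ℝ) + 1) ^ 4) :=
          mul_le_mul_of_nonneg_left (div_le_div_of_nonneg_right h (by positivity)) (by norm_num)
      _ = 432 * (8 * K + 2) / (2 * (M : ℝ) + 1) := by field_simp; ring
  linarith

/-- ★★★ **VAN HOVE WITH ARBITRARY BOUNDARY CONDITIONS, UNIFORMLY IN THE BOUNDARY FIELD** (`SU(2)`, `d = 4`, tree coupling `0 ≤ b ≤ 9/50`): for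
every `ε > 0` there is `M₀` such that for ALL cube radii `M ≥ M₀` and ALL boundary fields `η`,
`|log Z_{Λ_M}(b|η)/#T(Λ_M) − f(b)/6| ≤ ε`. [folklore] -/
theorem su2_log_normaliser_box_div_uniform_limit {b : ℝ} (hb0 : 0 ≤ b) (hb : b ≤ 9 / 50) {ε : ℝ} (hε : 0 < ε) :
    ∃ M₀ : ℕ, ∀ M : ℕ, M₀ ≤ M → ∀ η : LGConfig 4 (SUN 2),
      |Real.log (∫ ζ, Real.exp (-b * wilsonBoundaryAction (fundamentalRep (Fin 2)) (boxLinks 4 M) (glueWith (boxLinks 4 M) ζ η))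
            ∂(Measure.pi fun _ : ↥(boxLinks 4 M) => haarProbability (SUN 2))) / (plaquettesTouching (boxLinks 4 M)).card -
          freeEnergyDensity 4 (fundamentalRep (Fin 2)) b / 6| ≤ ε := by
  set κ : ℝ := starRate 4 (gaugeR (2 * b)) with hκ
  have hκ0 : 0 < κ := starRate_pos (gaugeR_nonneg (by linarith) (by linarith)) (gaugeR_lt_one_of_le (by linarith) (by linarith))
  set C : ℝ := 1024 * Real.sqrt 2 with hC
  have hC0 : 0 < C := by positivity
  -- depth budget `K`: `(b+1)·C·e^{−κK} ≤ ε/2`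
  obtain ⟨K, hK⟩ : ∃ K : ℕ, (b + 1) * C * Real.exp (-(κ * K)) ≤ ε / 2 := by
    have ht : Tendsto (fun K : ℕ => (b + 1) * C * Real.exp (-(κ * K))) atTop (𝓝 ((b + 1) * C * 0)) := by
      refine tendsto_const_nhds.mul ?_
      have h1 : Tendsto (fun K : ℕ => κ * (K : ℝ)) atTop atTop :=
        Tendsto.const_mul_atTop hκ0 tendsto_natCast_atTop_atTop
      exact Real.tendsto_exp_neg_atTop_nhds_zero.comp h1
    rw [mul_zero] at ht
    exact (ht.eventually (eventually_le_nhds (by linarith))).exists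
  -- volume budget `M₀`: `(b+1)·432(8K+2)/(2M+1) ≤ ε/2` and `4K ≤ M`
  obtain ⟨M₁, hM₁⟩ : ∃ M₁ : ℕ, ∀ M : ℕ, M₁ ≤ M → (b + 1) * (432 * (8 * K + 2)) / (2 * (M : ℝ) + 1) ≤ ε / 2 := by
    have ht : Tendsto (fun M : ℕ => (b + 1) * (432 * (8 * K + 2)) / (2 * (M : ℝ) + 1)) atTop (𝓝 0) := by
      refine Tendsto.div_atTop tendsto_const_nhds ?_
      exact tendsto_atTop_add_const_right _ _ (Tendsto.const_mul_atTop (by norm_num) tendsto_natCast_atTop_atTop)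
    obtain ⟨M₁, hM₁⟩ := (ht.eventually (eventually_le_nhds (by linarith : (0 : ℝ) < ε / 2))).exists_forall_of_atTop
    exact ⟨M₁, hM₁⟩
  refine ⟨max M₁ (4 * K), fun M hM η => ?_⟩
  have hKM : 4 * K ≤ M := le_of_max_le_right hM
  have hM1 : M₁ ≤ M := le_of_max_le_left hM
  refine (su2_abs_log_normaliser_box_div_sub_le_inv hb0 hb hKM η).trans ?_
  have hMpos : (0 : ℝ) < 2 * (M : ℝ) + 1 := by positivity
  have e1 : b * (C * Real.exp (-(κ * K))) ≤ ε / 2 := by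
    have : b * (C * Real.exp (-(κ * K))) ≤ (b + 1) * C * Real.exp (-(κ * K)) := by
      have : 0 ≤ C * Real.exp (-(κ * K)) := by positivity
      nlinarith
    linarith [hK]
  have e2 : b * (432 * (8 * K + 2) / (2 * (M : ℝ) + 1)) ≤ ε / 2 := by
    set X : ℝ := 432 * (8 * K + 2) / (2 * (M : ℝ) + 1) with hX
    have h0 : 0 ≤ X := by positivity
    have h1 : b * X ≤ (b + 1) * X := by nlinarith
    have h2 : (b + 1) * X = (b + 1) * (432 * (8 * K + 2)) / (2 * (M : ℝ) + 1) := by rw [hX]; ring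
    linarith [hM₁ M hM1]
  have : b * (C * Real.exp (-(κ * K)) + 432 * (8 * K + 2) / (2 * (M : ℝ) + 1)) ≤ ε := by rw [mul_add]; linarith
  simpa [hC, hκ, mul_comm, mul_left_comm, mul_assoc] using this

/-! ### The energy per plaquette with an arbitrary boundary field -/

/-- **The cube's surface sum**: for `0 ≤ κ`, `0 ≤ C`, `4K ≤ M`,
`Σ_{p∈T(Λ_M)} min 4 (C·e^{−κ⌊(M − ‖p.1‖)/4⌋}) ≤ C·e^{−κK}·#T(Λ_M) + 24·((2M+3)⁴ − (2(M−4K)+1)⁴)` (deep plaquettes + shallow layer). [folklore] -/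
theorem surface_sum_box_le {κ C : ℝ} (hκ : 0 ≤ κ) (hC : 0 ≤ C) {M K : ℕ} (hK : 4 * K ≤ M) :
    ∑ p ∈ plaquettesTouching (boxLinks 4 M), min 4 (C * Real.exp (-(κ * ⌊((M : ℝ) - ‖p.1‖) / (4 : ℕ)⌋₊))) ≤
      C * Real.exp (-(κ * K)) * (plaquettesTouching (boxLinks 4 M)).card +
        24 * ((2 * (M : ℝ) + 3) ^ 4 - (2 * ((M : ℝ) - 4 * K) + 1) ^ 4) := by
  classical
  set T := plaquettesTouching (boxLinks 4 M) with hT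
  rw [← Finset.sum_filter_add_sum_filter_not T (fun p => ((M : ℝ) - 4 * K) < ‖p.1‖)]
  have hsh : ∑ p ∈ T.filter (fun p => ((M : ℝ) - 4 * K) < ‖p.1‖), min 4 (C * Real.exp (-(κ * ⌊((M : ℝ) - ‖p.1‖) / (4 : ℕ)⌋₊))) ≤
      4 * (6 * ((2 * (M : ℝ) + 3) ^ 4 - (2 * ((M : ℝ) - 4 * K) + 1) ^ 4)) := by
    refine (Finset.sum_le_card_nsmul _ _ 4 fun p _ => min_le_left _ _).trans ?_
    rw [nsmul_eq_mul, mul_comm]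
    exact mul_le_mul_of_nonneg_left (card_shallow_le hK) (by norm_num)
  have hdp : ∑ p ∈ T.filter (fun p => ¬((M : ℝ) - 4 * K) < ‖p.1‖), min 4 (C * Real.exp (-(κ * ⌊((M : ℝ) - ‖p.1‖) / (4 : ℕ)⌋₊))) ≤
      C * Real.exp (-(κ * K)) * T.card := by
    refine (Finset.sum_le_card_nsmul _ _ (C * Real.exp (-(κ * K))) fun p hp => ?_).trans ?_
    · have h1 : ‖p.1‖ ≤ (M : ℝ) - 4 * K := not_lt.1 (Finset.mem_filter.1 hp).2
      have h2 : (K : ℝ) ≤ ((M : ℝ) - ‖p.1‖) / (4 : ℕ) := by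
        rw [le_div_iff₀ (by norm_num)]; push_cast; linarith
      have hpK : (K : ℝ) ≤ ⌊((M : ℝ) - ‖p.1‖) / (4 : ℕ)⌋₊ := by exact_mod_cast (Nat.le_floor h2)
      refine (min_le_right _ _).trans (mul_le_mul_of_nonneg_left (Real.exp_le_exp.2 ?_) hC)
      nlinarith
    · rw [nsmul_eq_mul]
      have hc : ((T.filter (fun p => ¬((M : ℝ) - 4 * K) < ‖p.1‖)).card : ℝ) ≤ T.card := by
        exact_mod_cast Finset.card_filter_le _ _
      have : 0 ≤ C * Real.exp (-(κ * K)) := by positivity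
      nlinarith
  linarith

/-- ★★ **THE MEAN ENERGY PER PLAQUETTE OF A CUBE WITH AN ARBITRARY BOUNDARY FIELD, `1/M` RATE** (`SU(2)`, `d = 4`, tree coupling `0 ≤ b ≤ 9/50`,
`μ` the DLR state at `b` — unique and axis-symmetric on the window): for every `4K ≤ M` and EVERY boundary field `η`,
`|γ_{Λ_M}^b(S_{Λ_M}|η)/#T(Λ_M) − (2 − μ(Re tr U_{p₀}))| ≤ 1024√2·exp(−κ₁(R_G(2b))·K) + 432(8K+2)/(2M+1)`. [folklore] -/
theorem su2_abs_kernel_energy_box_div_sub_le_inv {b : ℝ} (hb0 : 0 ≤ b) (hb : b ≤ 9 / 50)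
    {μ : Measure (LGConfig 4 (SUN 2))} (hμ : μ ∈ ymGibbsMeasures (d := 4) (fundamentalRep (Fin 2)) b) {M K : ℕ} (hK : 4 * K ≤ M)
    (η : LGConfig 4 (SUN 2)) :
    |(∫ U, wilsonBoundaryAction (fundamentalRep (Fin 2)) (boxLinks 4 M) U
          ∂(ymSpecification (d := 4) (fundamentalRep (Fin 2)) b (boxLinks 4 M) η)) / (plaquettesTouching (boxLinks 4 M)).card -
        ((2 : ℝ) - ∫ U, plaquetteObs (fundamentalRep (Fin 2)) 0 0 1 U ∂μ)| ≤
      1024 * Real.sqrt 2 * Real.exp (-(starRate 4 (gaugeR (2 * b)) * K)) + 432 * (8 * K + 2) / (2 * (M : ℝ) + 1) := by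
  classical
  have hρc : Continuous (fundamentalRep (Fin 2)) := continuous_fundamentalRep (Fin 2)
  set T := plaquettesTouching (boxLinks 4 M) with hT
  set κ : ℝ := starRate 4 (gaugeR (2 * b)) with hκ
  set C : ℝ := 1024 * Real.sqrt 2 with hC
  have hC0 : 0 ≤ C := by positivity
  have hκ0 : 0 ≤ κ := (starRate_pos (gaugeR_nonneg (by linarith) (by linarith)) (gaugeR_lt_one_of_le (by linarith) (by linarith))).le
  -- the one state is axis symmetric: all plaquette means agree
  obtain ⟨ν, h1, h2, -, -⟩ := su2_wilson_oneState_symmetric (b := b) (abs_le.2 ⟨by linarith, hb⟩)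
  have hμν : μ = ν := by rw [h1] at hμ; exact Set.mem_singleton_iff.1 hμ
  have hνL : ν ∈ infiniteVolumeLimitPoints (d := 4) (fundamentalRep (Fin 2)) b := by rw [h2]; exact Set.mem_singleton _
  have hplane : ∀ p ∈ T, ∫ U, plaquetteObs (fundamentalRep (Fin 2)) p.1 p.2.1.1 p.2.1.2 U ∂μ =
      ∫ U, plaquetteObs (fundamentalRep (Fin 2)) 0 0 1 U ∂μ := fun p _ => by
    rw [hμν]; exact PlaquettePositivity.integral_plaquetteObs_eq (fundamentalRep (Fin 2)) hρc (by norm_num) hνL p.1 (ne_of_lt p.2.2)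
  -- the energy theorem with the cube's canonical depth
  have hmain := su2_abs_kernel_energy_sub_le hb0 hb hμ (boxLinks 4 M) η (fun x => (M : ℝ) + 1 - ‖x.1‖)
    (fun x y => by
      have h := norm_le_norm_add_norm_sub' y.1 x.1
      rw [norm_sub_rev] at h
      linarith)
    (fun x hx => by rw [mem_boxLinks]; exact mem_siteBox_of_norm_lt (by linarith))
    (fun p => (M : ℝ) - ‖p.1‖) (fun p _ x hx => by have h := norm_fst_le_of_mem_plaquetteEdges hx; linarith)
  rw [Finset.sum_congr rfl fun p hp => by rw [hplane p hp], Finset.sum_const, nsmul_eq_mul] at hmain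
  -- volume and surface
  have hTge : 6 * (2 * (M : ℝ) + 1) ^ 4 ≤ (T.card : ℝ) := by
    have h := Finset.card_le_card (siteBox_product_subset_plaquettesTouching M)
    rw [Finset.card_product, ThermodynamicVariance.card_siteBox, Finset.card_univ,
      show Fintype.card {q : Fin 4 × Fin 4 // q.1 < q.2} = 6 from by decide] at h
    have h' : (((2 * M + 1) ^ 4 * 6 : ℕ) : ℝ) ≤ (T.card : ℝ) := by exact_mod_cast h
    push_cast at h'
    linarith
  have hMpos : (0 : ℝ) < 2 * (M : ℝ) + 1 := by positivity
  have hTpos : (0 : ℝ) < (T.card : ℝ) := lt_of_lt_of_le (by positivity) hTge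
  have hS := surface_sum_box_le hκ0 hC0 hK
  have h4 := pow_four_sub_pow_four_le hK
  rw [show (∫ U, wilsonBoundaryAction (fundamentalRep (Fin 2)) (boxLinks 4 M) U
          ∂(ymSpecification (d := 4) (fundamentalRep (Fin 2)) b (boxLinks 4 M) η)) / (T.card : ℝ) -
        ((2 : ℝ) - ∫ U, plaquetteObs (fundamentalRep (Fin 2)) 0 0 1 U ∂μ) =
      ((∫ U, wilsonBoundaryAction (fundamentalRep (Fin 2)) (boxLinks 4 M) U
          ∂(ymSpecification (d := 4) (fundamentalRep (Fin 2)) b (boxLinks 4 M) η)) -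
        (T.card : ℝ) * ((2 : ℝ) - ∫ U, plaquetteObs (fundamentalRep (Fin 2)) 0 0 1 U ∂μ)) / (T.card : ℝ) by field_simp,
    abs_div, abs_of_pos hTpos, div_le_iff₀ hTpos]
  refine hmain.trans ?_
  -- `S ≤ C e^{−κK} #T + 24·108(8K+2)(2M+1)³ ≤ (C e^{−κK} + 432(8K+2)/(2M+1))·#T`
  have hfrac : 24 * ((2 * (M : ℝ) + 3) ^ 4 - (2 * ((M : ℝ) - 4 * K) + 1) ^ 4) ≤ 432 * (8 * K + 2) / (2 * (M : ℝ) + 1) * T.card := by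
    have hK0 : (0 : ℝ) ≤ 8 * K + 2 := by positivity
    have e : 432 * (8 * K + 2) / (2 * (M : ℝ) + 1) * (6 * (2 * (M : ℝ) + 1) ^ 4) = 2592 * (8 * K + 2) * (2 * (M : ℝ) + 1) ^ 3 := by
      field_simp; ring
    have hmono : 432 * (8 * K + 2) / (2 * (M : ℝ) + 1) * (6 * (2 * (M : ℝ) + 1) ^ 4) ≤ 432 * (8 * K + 2) / (2 * (M : ℝ) + 1) * T.card :=
      mul_le_mul_of_nonneg_left hTge (by positivity)
    nlinarith [h4, hmono, e]
  nlinarith [hS, hfrac]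

/-- ★★★ **THE MEAN ENERGY PER PLAQUETTE WITH ARBITRARY BOUNDARY CONDITIONS CONVERGES, UNIFORMLY IN THE BOUNDARY FIELD** (`SU(2)`, `d = 4`,
tree coupling `0 ≤ b ≤ 9/50`, `μ` the DLR state at `b`): for every `ε > 0` there is `M₀` with
`|γ_{Λ_M}^b(S_{Λ_M}|η)/#T(Λ_M) − (2 − μ(Re tr U_{p₀}))| ≤ ε` for ALL `M ≥ M₀` and ALL boundary fields `η`. [folklore] -/
theorem su2_kernel_energy_box_div_uniform_limit {b : ℝ} (hb0 : 0 ≤ b) (hb : b ≤ 9 / 50)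
    {μ : Measure (LGConfig 4 (SUN 2))} (hμ : μ ∈ ymGibbsMeasures (d := 4) (fundamentalRep (Fin 2)) b) {ε : ℝ} (hε : 0 < ε) :
    ∃ M₀ : ℕ, ∀ M : ℕ, M₀ ≤ M → ∀ η : LGConfig 4 (SUN 2),
      |(∫ U, wilsonBoundaryAction (fundamentalRep (Fin 2)) (boxLinks 4 M) U
            ∂(ymSpecification (d := 4) (fundamentalRep (Fin 2)) b (boxLinks 4 M) η)) / (plaquettesTouching (boxLinks 4 M)).card -
          ((2 : ℝ) - ∫ U, plaquetteObs (fundamentalRep (Fin 2)) 0 0 1 U ∂μ)| ≤ ε := by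
  set κ : ℝ := starRate 4 (gaugeR (2 * b)) with hκ
  have hκ0 : 0 < κ := starRate_pos (gaugeR_nonneg (by linarith) (by linarith)) (gaugeR_lt_one_of_le (by linarith) (by linarith))
  set C : ℝ := 1024 * Real.sqrt 2 with hC
  obtain ⟨K, hK⟩ : ∃ K : ℕ, C * Real.exp (-(κ * K)) ≤ ε / 2 := by
    have ht : Tendsto (fun K : ℕ => C * Real.exp (-(κ * K))) atTop (𝓝 (C * 0)) :=
      tendsto_const_nhds.mul (Real.tendsto_exp_neg_atTop_nhds_zero.comp (Tendsto.const_mul_atTop hκ0 tendsto_natCast_atTop_atTop))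
    rw [mul_zero] at ht
    exact (ht.eventually (eventually_le_nhds (by linarith))).exists
  obtain ⟨M₁, hM₁⟩ : ∃ M₁ : ℕ, ∀ M : ℕ, M₁ ≤ M → 432 * (8 * (K : ℝ) + 2) / (2 * (M : ℝ) + 1) ≤ ε / 2 := by
    have ht : Tendsto (fun M : ℕ => 432 * (8 * (K : ℝ) + 2) / (2 * (M : ℝ) + 1)) atTop (𝓝 0) := by
      refine Tendsto.div_atTop tendsto_const_nhds ?_
      exact tendsto_atTop_add_const_right _ _ (Tendsto.const_mul_atTop (by norm_num) tendsto_natCast_atTop_atTop)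
    obtain ⟨M₁, hM₁⟩ := (ht.eventually (eventually_le_nhds (by linarith : (0 : ℝ) < ε / 2))).exists_forall_of_atTop
    exact ⟨M₁, hM₁⟩
  refine ⟨max M₁ (4 * K), fun M hM η => ?_⟩
  have h := su2_abs_kernel_energy_box_div_sub_le_inv hb0 hb hμ (le_of_max_le_right hM) η
  linarith [hM₁ M (le_of_max_le_left hM)]

end BoundaryFreeEnergy

end Summit.Ventures.YMGap.RobustBall

end
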